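import Literature.Combinatorics.StablePolynomials.SchurHadamardProduct
import Mathlib.LinearAlgebra.Matrix.Hermitian
import HarnessLib

/-!
# The Lee–Yang circle theorem via Hinkkanen's composition theorem (Borcea–Brändén II, Theorem 8.4, Remark 8.2)

J. Borcea, P. Brändén, *The Lee–Yang and Pólya–Schur programs. II.*, Comm. Pure Appl. Math. 62 (2009)
1595–1631 (arXiv:0809.3087), §8.2:

> **Theorem 8.4.** Let `A = (a_{ij})` be a Hermitian `n × n` matrix whose entries are in the closed unit disk
> `𝔻̄`. Then the polynomial `f(z_1,…,z_n) = Σ_{S ⊆ [n]} z^S Π_{i∈S} Π_{j∉S} a_{ij}` is `𝔻`-stable. In particular,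
> `f(z,…,z)` has all its zeros on the unit circle.
>
> **Remark 8.2.** The proof of Theorem 8.4 given in [hink] is as follows. For `i, j ∈ [n]` with `i < j` let
> `f_{ij}(z_1,…,z_n) = (1 + a_{ij} z_i + \overline{a_{ij}} z_j + z_i z_j) Π_{k ∈ [n]∖{i,j}} (1 + z_k)`. It is not
> hard to see that `f_{ij}` is `𝔻`-stable and by taking the Schur–Hadamard product of all these polynomials one
> gets `(f_{12} • ⋯ • f_{(n-1)n})(z) = Σ_{S⊆[n]} z^S Π_{i∈S} Π_{j∉S} a_{ij}`, which is again `𝔻`-stable by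
> Theorem 8.5.

This file carries out Remark 8.2 on top of `hinkkanen_schurHadamard` (Theorem 8.5, `SchurHadamardProduct.lean`):
the coefficient calculus of the tree's multi-affine coefficient form `multiAffine`, `𝔻`-stability of the
`f_{ij}` (the identity `|1 + a z|² - |ā + z|² = (1 - |a|²)(1 - |z|²)`), the iterated Schur–Hadamard product
(non-zero because its constant coefficient is `1`), and the identity of coefficients
`Π_{i<j} [z^S] f_{ij} = Π_{i∈S} Π_{j∉S} a_{ij}`, and the univariate consequence: the coefficients satisfy
`c(Sᶜ) = \overline{c(S)}`, so `f(t,…,t) = tⁿ \overline{f(1/ t̄,…,1/ t̄)}` and a zero with `|t| > 1` would give one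
with `|t| < 1`.

## Contents

* §1 `coeff_multiAffine_of_not_indicator`, `schurHadamard_multiAffine`, `isDiskStable_multiAffine_iff`,
  `isDiskStable_multiAffine_one` (with the tree's `coeff_multiAffine_indicator`, `isMultiAffine_multiAffine` of
  `KernelForm.lean`).
* §2 `isDiskStable_multiAffine_prod` — iterated Schur–Hadamard products (Theorem 8.5, induction).
* §3 `leeYangPair`, `eval_multiAffine_leeYangPair`, `isDiskStable_multiAffine_leeYangPair` (the `f_{ij}`).
* §4 `prod_leeYangPair_eq` (coefficients of the iterated product), **`leeYang_circle_theorem`** (Theorem 8.4,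
  `𝔻`-stability of `Σ_S z^S Π_{i∈S}Π_{j∉S} a_{ij}`).
* §5 `conj_leeYangCoeff`, `eval_const_multiAffine`, `leeYang_diagonal_reflect`,
  **`leeYang_circle_theorem_univariate`** ("`f(z,…,z)` has all its zeros on the unit circle").

## References

* [BorceaBranden2009II] J. Borcea, P. Brändén, Comm. Pure Appl. Math. 62 (2009) 1595–1631, §8.2 Thm 8.4,
  Remark 8.2, Thm 8.5.
-/

noncomputable section

open MvPolynomial Finset

open scoped ComplexConjugate

namespace Literature.Combinatorics.StablePolynomials

variable {σ : Type*} [Fintype σ] [DecidableEq σ]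

/-! ## §1 Coefficient calculus of the multi-affine coefficient form -/

section Coeff

/-- Non-square-free coefficients of `Σ_S a(S) z^S` vanish. [cite: BorceaBranden2009, §2.1] -/
theorem coeff_multiAffine_of_not_indicator (a : Finset σ → ℂ) {m : σ →₀ ℕ}
    (hm : ∀ S : Finset σ, (∑ i ∈ S, Finsupp.single i 1 : σ →₀ ℕ) ≠ m) : coeff m (multiAffine a) = 0 := by
  rw [coeff_multiAffine]
  exact sum_eq_zero fun S _ => if_neg (hm S)

/-- **The Schur–Hadamard product in coefficient form**: `(Σ a(S)z^S) • (Σ b(S)z^S) = Σ a(S)b(S)z^S`.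
[cite: BorceaBranden2009II, §8.2 (definition of `f • g`)] -/
theorem schurHadamard_multiAffine (a b : Finset σ → ℂ) :
    schurHadamard (multiAffine a) (multiAffine b) = multiAffine fun S => a S * b S := by
  ext m
  rw [coeff_schurHadamard]
  by_cases h : ∃ S : Finset σ, (∑ i ∈ S, Finsupp.single i 1 : σ →₀ ℕ) = m
  · obtain ⟨S, rfl⟩ := h
    rw [coeff_multiAffine_indicator, coeff_multiAffine_indicator, coeff_multiAffine_indicator]
  · push Not at h
    rw [coeff_multiAffine_of_not_indicator a h, zero_mul, coeff_multiAffine_of_not_indicator _ h]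

omit [DecidableEq σ] in
/-- `𝔻`-stability of the coefficient form, unfolded. [cite: BorceaBranden2009II, §1 and §8.2] -/
theorem isDiskStable_multiAffine_iff (a : Finset σ → ℂ) :
    IsDiskStable (multiAffine a) ↔ ∀ z : σ → ℂ, (∀ i, ‖z i‖ < 1) → (∑ S : Finset σ, a S * ∏ i ∈ S, z i) ≠ 0 := by
  simp only [IsDiskStable, eval_multiAffine]

omit [DecidableEq σ] in
/-- `Σ_S z^S = Π_k (1 + z_k)` is `𝔻`-stable (the empty Schur–Hadamard product). [cite: BorceaBranden2009II, §8.2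
Remark 8.2] -/
theorem isDiskStable_multiAffine_one : IsDiskStable (multiAffine fun _ : Finset σ => (1 : ℂ)) := by
  rw [isDiskStable_multiAffine_iff]
  intro z hz
  simp only [one_mul]
  rw [← powerset_univ, ← prod_one_add]
  -- `1 + z_i ≠ 0` for `|z_i| < 1` (the tree's `RadialChordal.one_add_ne_zero`, re-derived in two lines)
  refine prod_ne_zero_iff.2 fun i _ h => ?_
  have h2 : z i = -1 := by linear_combination h
  have h3 := hz i
  rw [h2, norm_neg, norm_one] at h3
  exact lt_irrefl _ h3

end Coeff

/-! ## §2 Iterated Schur–Hadamard products -/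

section Iterated

/-- **Iterated Schur–Hadamard products of `𝔻`-stable multi-affine polynomials with constant term `1` are
`𝔻`-stable** (Theorem 8.5 repeatedly; the product is never `0` since its constant coefficient is `1`).
[cite: BorceaBranden2009II, §8.2 Remark 8.2 ("by taking the Schur–Hadamard product of all these polynomials …
which is again `𝔻`-stable by Theorem 8.5")] -/
theorem isDiskStable_multiAffine_prod {ι : Type*} (P : Finset ι) (c : ι → Finset σ → ℂ)
    (hc : ∀ p ∈ P, IsDiskStable (multiAffine (c p))) (h1 : ∀ p ∈ P, c p ∅ = 1) :
    IsDiskStable (multiAffine fun S => ∏ p ∈ P, c p S) := by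
  classical
  induction P using Finset.induction_on with
  | empty =>
    simp only [prod_empty]
    exact isDiskStable_multiAffine_one
  | insert p P hp ih =>
    have hcp := hc p (mem_insert_self p P)
    have hP := ih (fun q hq => hc q (mem_insert_of_mem hq)) fun q hq => h1 q (mem_insert_of_mem hq)
    have h := hinkkanen_schurHadamard (isMultiAffine_multiAffine (c p)) (isMultiAffine_multiAffine _) hcp hP
    rw [schurHadamard_multiAffine] at h
    have heq : (fun S => c p S * ∏ q ∈ P, c q S) = fun S => ∏ q ∈ insert p P, c q S :=
      funext fun S => by rw [prod_insert hp]
    rw [heq] at h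
    rcases h with h | h
    · exact h
    · exfalso
      have h0 := congrArg (coeff (∑ i ∈ (∅ : Finset σ), Finsupp.single i 1)) h
      rw [coeff_multiAffine_indicator, coeff_zero, prod_eq_one fun q hq => h1 q hq] at h0
      exact one_ne_zero h0

end Iterated

/-! ## §3 The polynomials `f_{ij}` -/

section Pair

/-- **The coefficients of `f_{ij} = (1 + a z_i + b z_j + z_i z_j) Π_{k ≠ i,j} (1 + z_k)`**:
`[z^S] f_{ij}` is `1`, `a`, `b`, `1` according as `S ∩ {i,j} = {i,j}, {i}, {j}, ∅`.
[cite: BorceaBranden2009II, §8.2 Remark 8.2 (definition of `f_{ij}`)] -/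
def leeYangPair (i j : σ) (a b : ℂ) (S : Finset σ) : ℂ :=
  if i ∈ S then (if j ∈ S then 1 else a) else (if j ∈ S then b else 1)

/-- **`Σ_S [z^S]f_{ij} z^S = (1 + a z_i + b z_j + z_i z_j) Π_{k ≠ i,j} (1 + z_k)`** pointwise.
[cite: BorceaBranden2009II, §8.2 Remark 8.2] -/
theorem eval_multiAffine_leeYangPair {i j : σ} (hij : i ≠ j) (a b : ℂ) (z : σ → ℂ) :
    eval z (multiAffine (leeYangPair i j a b)) =
      (1 + a * z i + b * z j + z i * z j) * ∏ k ∈ (univ.erase i).erase j, (1 + z k) := by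
  rw [eval_multiAffine]
  set R : Finset σ := (univ.erase i).erase j with hR
  have hiR : i ∉ R := fun h => (mem_erase.1 (mem_erase.1 h).2).1 rfl
  have hjR : j ∉ R := fun h => (mem_erase.1 h).1 rfl
  have hij' : i ∉ insert j R := fun h => by
    rcases mem_insert.1 h with h | h
    · exact hij h
    · exact hiR h
  have huniv : (univ : Finset (Finset σ)) = (insert i (insert j R)).powerset := by
    rw [← powerset_univ]
    congr 1
    rw [hR, insert_erase (mem_erase.2 ⟨Ne.symm hij, mem_univ j⟩), insert_erase (mem_univ i)]
  rw [huniv, sum_powerset_insert hij', sum_powerset_insert hjR, sum_powerset_insert hjR]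
  -- the four groups of subsets
  have hval : ∀ S ∈ R.powerset,
      leeYangPair i j a b S * ∏ k ∈ S, z k = ∏ k ∈ S, z k ∧
      leeYangPair i j a b (insert j S) * ∏ k ∈ insert j S, z k = b * z j * ∏ k ∈ S, z k ∧
      leeYangPair i j a b (insert i S) * ∏ k ∈ insert i S, z k = a * z i * ∏ k ∈ S, z k ∧
      leeYangPair i j a b (insert i (insert j S)) * ∏ k ∈ insert i (insert j S), z k =
        z i * z j * ∏ k ∈ S, z k := by
    intro S hS
    have hS' := mem_powerset.1 hS
    have hiS : i ∉ S := fun h => hiR (hS' h)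
    have hjS : j ∉ S := fun h => hjR (hS' h)
    have hijS : i ∉ insert j S := fun h => by
      rcases mem_insert.1 h with h | h
      · exact hij h
      · exact hiS h
    refine ⟨?_, ?_, ?_, ?_⟩
    · rw [leeYangPair, if_neg hiS, if_neg hjS, one_mul]
    · rw [leeYangPair, if_neg (fun h => hiS ((mem_insert.1 h).resolve_left hij)), if_pos (mem_insert_self j S),
        prod_insert hjS, mul_assoc]
    · rw [leeYangPair, if_pos (mem_insert_self i S), if_neg (fun h => hjS ((mem_insert.1 h).resolve_left (Ne.symm hij))),
        prod_insert hiS, mul_assoc]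
    · rw [leeYangPair, if_pos (mem_insert_self i _), if_pos (mem_insert_of_mem (mem_insert_self j S)), one_mul,
        prod_insert hijS, prod_insert hjS, mul_assoc]
  rw [sum_congr rfl fun S hS => (hval S hS).1, sum_congr rfl fun S hS => (hval S hS).2.1,
    sum_congr rfl fun S hS => (hval S hS).2.2.1, sum_congr rfl fun S hS => (hval S hS).2.2.2,
    ← mul_sum, ← mul_sum, ← mul_sum, ← prod_one_add]
  ring

/-- `|1 + a z|² - |ā + z|² = (1 - |a|²)(1 - |z|²)`. [cite: BorceaBranden2009II, §8.2 Remark 8.2 ("it is not hard to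
see that `f_{ij}` is `𝔻`-stable")] -/
theorem normSq_one_add_mul_sub (a z : ℂ) :
    Complex.normSq (1 + a * z) - Complex.normSq (conj a + z) = (1 - Complex.normSq a) * (1 - Complex.normSq z) := by
  simp only [Complex.normSq_apply, Complex.add_re, Complex.add_im, Complex.mul_re, Complex.mul_im, Complex.one_re,
    Complex.one_im, Complex.conj_re, Complex.conj_im]
  ring

omit [DecidableEq σ] in
/-- **`1 + a z_i + ā z_j + z_i z_j ≠ 0` for `|z_i|, |z_j| < 1`, `|a| ≤ 1`.** [cite: BorceaBranden2009II, §8.2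
Remark 8.2 ("`f_{ij}` is `𝔻`-stable")] -/
theorem leeYang_quadratic_ne_zero {a u v : ℂ} (ha : ‖a‖ ≤ 1) (hu : ‖u‖ < 1) (hv : ‖v‖ < 1) :
    1 + a * u + conj a * v + u * v ≠ 0 := by
  intro h
  have h1 : 1 + a * u = -v * (conj a + u) := by linear_combination h
  have hnu : Complex.normSq u < 1 := by
    rw [Complex.normSq_eq_norm_sq]; nlinarith [norm_nonneg u]
  have hnv : Complex.normSq v < 1 := by
    rw [Complex.normSq_eq_norm_sq]; nlinarith [norm_nonneg v]
  have hna : Complex.normSq a ≤ 1 := by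
    rw [Complex.normSq_eq_norm_sq]; nlinarith [norm_nonneg a]
  have h2 : Complex.normSq (1 + a * u) = Complex.normSq v * Complex.normSq (conj a + u) := by
    rw [h1, Complex.normSq_mul, Complex.normSq_neg]
  have h3 := normSq_one_add_mul_sub a u
  have h4 : 0 ≤ Complex.normSq (conj a + u) := Complex.normSq_nonneg _
  -- `|1 + a u|² ≥ |ā + u|²` but `|1 + a u|² = |v|² |ā + u|² ≤ |ā + u|²`; equality forces `|ā + u| = 0`, `|a| = 1`
  have h5 : Complex.normSq (conj a + u) = 0 := by
    by_contra hne
    have hpos : 0 < Complex.normSq (conj a + u) := lt_of_le_of_ne h4 (Ne.symm hne)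
    nlinarith [mul_nonneg (sub_nonneg.2 hna) (sub_nonneg.2 hnu.le)]
  have h6 : conj a + u = 0 := Complex.normSq_eq_zero.1 h5
  have h7 : Complex.normSq a = 1 := by
    have h8 : Complex.normSq (1 + a * u) = 0 := by rw [h2, h5, mul_zero]
    nlinarith
  have h9 : u = -conj a := by linear_combination h6
  rw [h9, Complex.normSq_neg, Complex.normSq_conj, h7] at hnu
  exact lt_irrefl _ hnu

/-- **`f_{ij}` is `𝔻`-stable** for `i ≠ j`, `|a| ≤ 1`, `b = ā`. [cite: BorceaBranden2009II, §8.2 Remark 8.2] -/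
theorem isDiskStable_multiAffine_leeYangPair {i j : σ} (hij : i ≠ j) {a : ℂ} (ha : ‖a‖ ≤ 1) :
    IsDiskStable (multiAffine (leeYangPair i j a (conj a))) := by
  intro z hz
  rw [eval_multiAffine_leeYangPair hij]
  refine mul_ne_zero (leeYang_quadratic_ne_zero ha (hz i) (hz j)) (prod_ne_zero_iff.2 fun k _ h => ?_)
  have h2 : z k = -1 := by linear_combination h
  have h3 := hz k
  rw [h2, norm_neg, norm_one] at h3
  exact lt_irrefl _ h3

end Pair

/-! ## §4 Theorem 8.4 -/

section LeeYang

/-- **The coefficient identity of Remark 8.2**: `Π_{i<j} [z^S] f_{ij} = Π_{i∈S} Π_{j∉S} a_{ij}` (for any matrix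
`A`, with `b_{ij} = a_{ji}`; the pairs `i < j` are taken along an enumeration `e` of the variables).
[cite: BorceaBranden2009II, §8.2 Remark 8.2 ("`(f_{12} • ⋯ • f_{(n-1)n})(z) = Σ_S z^S Π_{i∈S}Π_{j∉S} a_{ij}`")] -/
theorem prod_leeYangPair_eq {m : ℕ} (e : σ → Fin m) (he : Function.Injective e) (A : Matrix σ σ ℂ)
    (S : Finset σ) :
    ∏ p ∈ (univ : Finset (σ × σ)).filter (fun p => e p.1 < e p.2), leeYangPair p.1 p.2 (A p.1 p.2) (A p.2 p.1) S =
      ∏ i ∈ S, ∏ j ∈ Sᶜ, A i j := by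
  -- each factor splits as (contribution with `p.1 ∈ S, p.2 ∉ S`) · (contribution with `p.1 ∉ S, p.2 ∈ S`)
  have hsplit : ∀ p : σ × σ, leeYangPair p.1 p.2 (A p.1 p.2) (A p.2 p.1) S =
      (if p.1 ∈ S ∧ p.2 ∉ S then A p.1 p.2 else 1) * (if p.1 ∉ S ∧ p.2 ∈ S then A p.2 p.1 else 1) := by
    intro p
    unfold leeYangPair
    by_cases h1 : p.1 ∈ S <;> by_cases h2 : p.2 ∈ S <;> simp [h1, h2]
  simp_rw [hsplit]
  rw [prod_mul_distrib, ← prod_filter, ← prod_filter, filter_filter, filter_filter, ← prod_product' S Sᶜ fun i j => A i j]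
  -- `S × Sᶜ` splits by the order of the enumeration
  rw [← prod_filter_mul_prod_filter_not (S ×ˢ Sᶜ) (fun p : σ × σ => e p.1 < e p.2)]
  congr 1
  · refine prod_congr ?_ fun _ _ => rfl
    ext p
    simp only [mem_filter, mem_univ, true_and, mem_product, mem_compl]
    tauto
  · -- the pairs with `e p.2 < e p.1`, reindexed by swapping
    refine prod_nbij' Prod.swap Prod.swap (fun p hp => ?_) (fun p hp => ?_) (fun _ _ => Prod.swap_swap _)
      (fun _ _ => Prod.swap_swap _) (fun _ _ => rfl)
    · simp only [mem_filter, mem_univ, true_and] at hp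
      simp only [mem_filter, mem_product, mem_compl, Prod.fst_swap, Prod.snd_swap]
      refine ⟨⟨hp.2.2, hp.2.1⟩, fun h => ?_⟩
      exact lt_asymm hp.1 h
    · simp only [mem_filter, mem_product, mem_compl] at hp
      simp only [mem_filter, mem_univ, true_and, Prod.fst_swap, Prod.snd_swap]
      refine ⟨?_, hp.1.2, hp.1.1⟩
      rcases lt_trichotomy (e p.2) (e p.1) with h | h | h
      · exact h
      · exact absurd (he h) fun h' => hp.1.2 (h' ▸ hp.1.1)
      · exact absurd h hp.2

/-- **Borcea–Brändén II, Theorem 8.4 (the Lee–Yang "circle theorem", multivariate form).** Let `A` be a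
Hermitian matrix over a finite index set with all entries in the closed unit disk. Then
`f(z) = Σ_S z^S Π_{i∈S} Π_{j∉S} a_{ij}` is `𝔻`-stable. Proof by Remark 8.2 (Hinkkanen): `f` is the Schur–Hadamard
product of the `𝔻`-stable polynomials `f_{ij}`, `i < j`, hence `𝔻`-stable by Theorem 8.5 (it is not `0`: its
constant coefficient is `1`). [cite: BorceaBranden2009II, §8.2 Thm. 8.4 and Remark 8.2] -/
theorem leeYang_circle_theorem (A : Matrix σ σ ℂ) (hA : A.IsHermitian) (h1 : ∀ i j, ‖A i j‖ ≤ 1) :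
    IsDiskStable (multiAffine fun S : Finset σ => ∏ i ∈ S, ∏ j ∈ Sᶜ, A i j) := by
  -- enumerate the variables to form the pairs `i < j`
  set e : σ → Fin (Fintype.card σ) := ⇑(Fintype.equivFin σ) with he'
  have he : Function.Injective e := (Fintype.equivFin σ).injective
  have hcoef : (fun S : Finset σ => ∏ i ∈ S, ∏ j ∈ Sᶜ, A i j) = fun S =>
      ∏ p ∈ (univ : Finset (σ × σ)).filter (fun p => e p.1 < e p.2),
        leeYangPair p.1 p.2 (A p.1 p.2) (A p.2 p.1) S :=
    funext fun S => (prod_leeYangPair_eq e he A S).symm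
  rw [hcoef]
  refine isDiskStable_multiAffine_prod _ (fun p : σ × σ => leeYangPair p.1 p.2 (A p.1 p.2) (A p.2 p.1))
    (fun p hp => ?_) fun p hp => ?_
  · have hp' : p.1 ≠ p.2 := fun h => by
      have := (mem_filter.1 hp).2
      rw [h] at this
      exact lt_irrefl _ this
    have hconj : A p.2 p.1 = conj (A p.1 p.2) := by
      rw [← hA.apply p.2 p.1]
      rfl
    rw [hconj]
    exact isDiskStable_multiAffine_leeYangPair hp' (h1 p.1 p.2)
  · simp [leeYangPair]

end LeeYang

/-! ## §5 The zeros of `f(z,…,z)` lie on the unit circle -/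

section Circle

/-- **`c(Sᶜ) = conj c(S)`** for the Lee–Yang coefficients `c(S) = Π_{i∈S}Π_{j∉S} a_{ij}` of a Hermitian matrix.
[cite: BorceaBranden2009II, §8.2 Thm. 8.4 ("In particular, `f(z,…,z)` has all its zeros on the unit circle")] -/
theorem conj_leeYangCoeff (A : Matrix σ σ ℂ) (hA : A.IsHermitian) (S : Finset σ) :
    conj (∏ i ∈ S, ∏ j ∈ Sᶜ, A i j) = ∏ i ∈ Sᶜ, ∏ j ∈ Sᶜᶜ, A i j := by
  rw [compl_compl, map_prod, prod_comm]
  refine prod_congr rfl fun j _ => ?_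
  rw [map_prod]
  refine prod_congr rfl fun i _ => ?_
  rw [starRingEnd_apply]
  exact hA.apply _ _

omit [DecidableEq σ] in
/-- `(Σ_S c(S) z^S)(t,…,t) = Σ_S c(S) t^{|S|}`. [cite: BorceaBranden2009II, §8.2 Thm. 8.4 (`f(z,…,z)`)] -/
theorem eval_const_multiAffine (c : Finset σ → ℂ) (t : ℂ) :
    eval (fun _ : σ => t) (multiAffine c) = ∑ S : Finset σ, c S * t ^ S.card := by
  rw [eval_multiAffine]
  simp only [prod_const]

/-- **Reflection identity**: for the Lee–Yang polynomial `f` of a Hermitian `A` and `t ≠ 0`,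
`f(t,…,t) = tⁿ · conj f(1/ t̄,…,1/ t̄)` (`n = |σ|`). [cite: BorceaBranden2009II, §8.2 Thm. 8.4 (the univariate
consequence)] -/
theorem leeYang_diagonal_reflect (A : Matrix σ σ ℂ) (hA : A.IsHermitian) {t : ℂ} (ht : t ≠ 0) :
    eval (fun _ : σ => t) (multiAffine fun S : Finset σ => ∏ i ∈ S, ∏ j ∈ Sᶜ, A i j) =
      t ^ Fintype.card σ * conj (eval (fun _ : σ => (conj t)⁻¹) (multiAffine fun S : Finset σ => ∏ i ∈ S, ∏ j ∈ Sᶜ, A i j)) := by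
  rw [eval_const_multiAffine, eval_const_multiAffine, map_sum, mul_sum]
  -- reindex the left-hand side by `S ↦ Sᶜ`
  rw [← sum_nbij' (fun S : Finset σ => Sᶜ) (fun S => Sᶜ) (fun _ _ => mem_univ _) (fun _ _ => mem_univ _)
    (fun S _ => compl_compl S) (fun S _ => compl_compl S) (fun S _ => rfl)]
  refine sum_congr rfl fun S _ => ?_
  rw [map_mul, conj_leeYangCoeff A hA S, map_pow, map_inv₀, Complex.conj_conj, card_compl, inv_pow,
    pow_sub₀ t ht (card_le_univ S)]
  ring

/-- **Borcea–Brändén II, Theorem 8.4, univariate consequence**: for a Hermitian `A` with entries in the closed unit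
disk, every zero of `f(z,…,z)` (the diagonal of the Lee–Yang polynomial) lies on the unit circle.
[cite: BorceaBranden2009II, §8.2 Thm. 8.4 ("In particular, `f(z,…,z)` has all its zeros on the unit circle")] -/
theorem leeYang_circle_theorem_univariate (A : Matrix σ σ ℂ) (hA : A.IsHermitian) (h1 : ∀ i j, ‖A i j‖ ≤ 1)
    {t : ℂ} (ht : eval (fun _ : σ => t) (multiAffine fun S : Finset σ => ∏ i ∈ S, ∏ j ∈ Sᶜ, A i j) = 0) :
    ‖t‖ = 1 := by
  have hst := leeYang_circle_theorem A hA h1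
  rcases lt_trichotomy ‖t‖ 1 with h | h | h
  · exact absurd ht (hst _ fun _ => h)
  · exact h
  · have ht0 : t ≠ 0 := fun h0 => by
      rw [h0, norm_zero] at h
      exact absurd h (by norm_num)
    rw [leeYang_diagonal_reflect A hA ht0, mul_eq_zero] at ht
    rcases ht with h2 | h2
    · exact absurd (eq_zero_of_pow_eq_zero h2) ht0
    · rw [map_eq_zero] at h2
      refine absurd h2 (hst _ fun _ => ?_)
      rw [norm_inv, Complex.norm_conj, inv_lt_one_iff₀]
      exact Or.inr h

end Circle

end Literature.Combinatorics.StablePolynomials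

end
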